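import Summits.AtomisticToContinuum.Crystallization.Theorems.SquareWellLayerCakeGapTwelveToBarlowCombinatorialLayeringTransportFiniteModel
import Summits.AtomisticToContinuum.Crystallization.Theorems.SquareWellLayerCakeGapTwelveToBarlowCombinatorialLayeringGradedData
import Summits.AtomisticToContinuum.Crystallization.Theorems.SquareWellLayerCakeGapTwelveToBarlowCombinatorialLayeringChartType

/-!
# Combinatorial layering (B1a of `GapTwelveToBarlow`): the finite development from a deep base site

Crux `SquareWellLayerCake.GapTwelveToBarlow` (stmt-AtomisticToContinuum-15807), line `Sketch`,
stub `stub_develop` (H_develop).  INSTANTIATION of the graded finite development (`finiteModel`,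
`layersFin_int` of the `…CombinatorialLayeringTransport*` port) on the charted window of the
stub, through `gradedData_of_charts` (chart type / base frames: `…ChartType`):
* `window_levels_antitone` (anchor) — the level sets of the window are antitone;
* `hch_restrict_fcc` — ALL-FCC RESTRICTION of graded chart data: keeping at level `m` the sites
  all of whose charted companions within Euclidean distance `m` are fcc-like is graded chart data
  again (closure: bonds have length `≤ 1`) in which every site is fcc-like (fcc base regime);
* `develop_abstract` — from a valid base frame of parity `+1` in the base regime at level
  `n + K + 4 + R` (`3K ≤ R`): a Hägg word `s` and `Ψ` on `barlowStacking 1 √(2/3) s`, `Ψ 0 = base`,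
  every covered model point (`|k| + 1 ≤ K`, `|j| + |i| + 3(|k| + 1) + 4 ≤ R`) mapped into level
  `n`, STAR-bijectively (model contacts ↔ bonded neighbours) and LINK-faithfully;
* `develop_translate` — back to indices `Fin N` (`x` is injective on the window);
* `develop_of_base` — the crux's finite language: in an all-Good `2D`-ball with integer charts at
  the ten-deep sites and transfer along bonds, from a base site `b` with
  `dist (x i) (x b) + 10 + (n + K + 4 + R) ≤ 2D` that is hcp-like, or all of whose charted
  companions within distance `n + K + 4 + R` are fcc-like, a Hägg word `s` and `Φ : ℝ³ → Fin N`,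
  `Φ 0 = b`, developing the model diamond STAR-bijectively and LINK-faithfully into the sites `j`
  with `dist (x i) (x j) + 10 + n ≤ 2D`.
Nothing is defined; no named fact is used.
-/

noncomputable section

namespace Summit.AtomisticToContinuum.Crystallization.Theorems.SquareWellLayerCakeGapTwelveToBarlow

open Literature.Geometry.DiscreteGeometry Literature.MathematicalPhysics.StatisticalMechanics
open Summit.AtomisticToContinuum.Crystallization.Theorems.PalmUnimodularRigidityShellsToBarlowChart
  (ZFrame IsFrame frameParity fcc3Int contacts)

/-! ## Levels of the window -/

/-- **The level sets of the window are antitone** (registered anchor of this file). [folklore] -/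
theorem window_levels_antitone :
    ∀ (N : ℕ) (x : Fin N → EuclideanSpace ℝ (Fin 3)) (i : Fin N) (D : ℝ) (m a : ℕ) (j : Fin N),
    dist (x i) (x j) + 10 + ((m + a : ℕ) : ℝ) ≤ 2 * D → dist (x i) (x j) + 10 + (m : ℝ) ≤ 2 * D
    := by
  intro N x i D m a j h
  push_cast at h
  linarith [(Nat.cast_nonneg a : (0 : ℝ) ≤ a)]

/-! ## The all-fcc restriction of graded chart data -/

section Abstract

variable {S : ℕ → Set (EuclideanSpace ℝ (Fin 3))}
  {B : EuclideanSpace ℝ (Fin 3) → EuclideanSpace ℝ (Fin 3) → Prop}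
  {Pc : EuclideanSpace ℝ (Fin 3) → Finset (Fin 3 → ℤ)}
  {nb : EuclideanSpace ℝ (Fin 3) → (Fin 3 → ℤ) → EuclideanSpace ℝ (Fin 3)}

/-- **All-fcc restriction.**  If bonds have length `≤ 1`, restricting level `m` of graded chart
data to the sites all of whose charted companions (sites of any level) within Euclidean distance
`m` are fcc-like gives graded chart data in which every site is fcc-like. [folklore] -/
theorem hch_restrict_fcc
    (hch : (∀ n : ℕ, ∀ z ∈ S n, (Pc z = fcc3Int ∨ Pc z = hcpInt) ∧
      Set.BijOn (nb z) (↑(Pc z) : Set (Fin 3 → ℤ)) {y | B z y} ∧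
      ∀ t ∈ Pc z, ∀ t' ∈ Pc z, (B (nb z t) (nb z t') ↔ sqNormInt (t - t') = 18)) ∧
    (∀ n : ℕ, ∀ z ∈ S (n + 1), ∀ y, B z y → y ∈ S n) ∧
    (∀ n m : ℕ, ∀ x ∈ S n, ∀ y ∈ S m, B x y →
      ∀ (z z' : EuclideanSpace ℝ (Fin 3)) (t t' u u' : Fin 3 → ℤ),
        (t = 0 ∧ z = x ∨ t ∈ Pc x ∧ z = nb x t) → (t' = 0 ∧ z' = x ∨ t' ∈ Pc x ∧ z' = nb x t') →
        (u = 0 ∧ z = y ∨ u ∈ Pc y ∧ z = nb y u) → (u' = 0 ∧ z' = y ∨ u' ∈ Pc y ∧ z' = nb y u') →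
        sqNormInt (u - u') = sqNormInt (t - t')) ∧
    (∀ x y, B x y → B y x))
    (hBd : ∀ x y, B x y → dist x y ≤ 1) (S' : ℕ → Set (EuclideanSpace ℝ (Fin 3)))
    (hS' : ∀ (m : ℕ) (z : EuclideanSpace ℝ (Fin 3)), z ∈ S' m ↔
      z ∈ S m ∧ ∀ m' : ℕ, ∀ y ∈ S m', dist z y ≤ m → Pc y = fcc3Int) :
    ((∀ n : ℕ, ∀ z ∈ S' n, (Pc z = fcc3Int ∨ Pc z = hcpInt) ∧
      Set.BijOn (nb z) (↑(Pc z) : Set (Fin 3 → ℤ)) {y | B z y} ∧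
      ∀ t ∈ Pc z, ∀ t' ∈ Pc z, (B (nb z t) (nb z t') ↔ sqNormInt (t - t') = 18)) ∧
    (∀ n : ℕ, ∀ z ∈ S' (n + 1), ∀ y, B z y → y ∈ S' n) ∧
    (∀ n m : ℕ, ∀ x ∈ S' n, ∀ y ∈ S' m, B x y →
      ∀ (z z' : EuclideanSpace ℝ (Fin 3)) (t t' u u' : Fin 3 → ℤ),
        (t = 0 ∧ z = x ∨ t ∈ Pc x ∧ z = nb x t) → (t' = 0 ∧ z' = x ∨ t' ∈ Pc x ∧ z' = nb x t') →
        (u = 0 ∧ z = y ∨ u ∈ Pc y ∧ z = nb y u) → (u' = 0 ∧ z' = y ∨ u' ∈ Pc y ∧ z' = nb y u') →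
        sqNormInt (u - u') = sqNormInt (t - t')) ∧
    (∀ x y, B x y → B y x)) ∧
    (∀ m : ℕ, ∀ z ∈ S' m, Pc z = fcc3Int) := by
  obtain ⟨hC, hCl, hT, hsy⟩ := hch
  refine ⟨⟨fun n z hz => hC n z ((hS' n z).1 hz).1, ?_, fun n m x hx y hy =>
    hT n m x ((hS' n x).1 hx).1 y ((hS' m y).1 hy).1, hsy⟩, ?_⟩
  · intro n z hz y hzy
    obtain ⟨hzS, hfcc⟩ := (hS' (n + 1) z).1 hz
    refine (hS' n y).2 ⟨hCl n z hzS y hzy, fun m' y' hy' hd => hfcc m' y' hy' ?_⟩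
    calc dist z y' ≤ dist z y + dist y y' := dist_triangle _ _ _
      _ ≤ 1 + (n : ℝ) := add_le_add (hBd z y hzy) hd
      _ = ((n + 1 : ℕ) : ℝ) := by push_cast; ring
  · intro m z hz
    obtain ⟨hzS, hfcc⟩ := (hS' m z).1 hz
    exact hfcc m z hzS (by rw [dist_self]; positivity)

/-- **The finite development, abstract form** (`finiteModel` + the levels of `layersFin_int`).
From a valid base frame `g₀` of parity `+1` in the base regime at level `n + K + 4 + R`
(`3K ≤ R`): a Hägg word `s` and `Ψ` on the model with `Ψ (barlowPos … 0 0 0) = g₀.pt` such that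
every covered model point is mapped into level `n`, STAR-bijectively from its model contacts onto
the `B`-neighbours of its image, and LINK-faithfully. [folklore] -/
theorem develop_abstract
    (hch : (∀ n : ℕ, ∀ z ∈ S n, (Pc z = fcc3Int ∨ Pc z = hcpInt) ∧
      Set.BijOn (nb z) (↑(Pc z) : Set (Fin 3 → ℤ)) {y | B z y} ∧
      ∀ t ∈ Pc z, ∀ t' ∈ Pc z, (B (nb z t) (nb z t') ↔ sqNormInt (t - t') = 18)) ∧
    (∀ n : ℕ, ∀ z ∈ S (n + 1), ∀ y, B z y → y ∈ S n) ∧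
    (∀ n m : ℕ, ∀ x ∈ S n, ∀ y ∈ S m, B x y →
      ∀ (z z' : EuclideanSpace ℝ (Fin 3)) (t t' u u' : Fin 3 → ℤ),
        (t = 0 ∧ z = x ∨ t ∈ Pc x ∧ z = nb x t) → (t' = 0 ∧ z' = x ∨ t' ∈ Pc x ∧ z' = nb x t') →
        (u = 0 ∧ z = y ∨ u ∈ Pc y ∧ z = nb y u) → (u' = 0 ∧ z' = y ∨ u' ∈ Pc y ∧ z' = nb y u') →
        sqNormInt (u - u') = sqNormInt (t - t')) ∧
    (∀ x y, B x y → B y x))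
    (hmono : ∀ n a : ℕ, S (n + a) ⊆ S n)
    {n K R : ℕ} {g₀ : ZFrame} (h₀ : IsFrame (Pc g₀.pt) g₀.t₁ g₀.t₂ g₀.U)
    (h₀S : g₀.pt ∈ S (n + K + 4 + R)) (h₀p : frameParity g₀.t₁ g₀.t₂ g₀.U = 1)
    (h₀A : (∀ m, ∀ z ∈ S m, Pc z = fcc3Int) ∨ Pc g₀.pt = hcpInt) (hKR : 3 * K ≤ R) :
    ∃ s : ℤ → ℤ, IsHaggSeq s ∧ ∃ Ψ : EuclideanSpace ℝ (Fin 3) → EuclideanSpace ℝ (Fin 3),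
      Ψ (barlowPos 1 (Real.sqrt (2 / 3)) s 0 0 0) = g₀.pt ∧
      ∀ k i j : ℤ, k.natAbs + 1 ≤ K → j.natAbs + i.natAbs + 3 * (k.natAbs + 1) + 4 ≤ R →
        Ψ (barlowPos 1 (Real.sqrt (2 / 3)) s k i j) ∈ S n ∧
        Set.BijOn Ψ (contacts s (barlowPos 1 (Real.sqrt (2 / 3)) s k i j))
          {z | B (Ψ (barlowPos 1 (Real.sqrt (2 / 3)) s k i j)) z} ∧
        ∀ q ∈ contacts s (barlowPos 1 (Real.sqrt (2 / 3)) s k i j),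
          ∀ q' ∈ contacts s (barlowPos 1 (Real.sqrt (2 / 3)) s k i j),
            (B (Ψ q) (Ψ q') ↔ dist q q' = 1) := by
  obtain ⟨s, hs, -, Ψ, hΨ, hstar⟩ := finiteModel hch h₀ h₀S h₀p h₀A hKR
  have hlev := layersFin_int hch h₀ h₀S h₀p h₀A hKR
  refine ⟨s, hs, Ψ, by rw [hΨ]; rfl, fun k i j hk hij => ?_⟩
  obtain ⟨hB, hL⟩ := hstar k i j hk hij
  refine ⟨?_, by rw [hΨ]; exact hB, hL⟩
  rw [hΨ]
  have h1 := ((hlev k (by omega)).1 i j (by omega)).2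
  have e : n + (K - k.natAbs) + (R - j.natAbs - i.natAbs) + 4 =
      n + ((K - k.natAbs) + (R - j.natAbs - i.natAbs) + 4) := by ring
  rw [e] at h1
  exact hmono n _ h1

end Abstract

/-! ## Back to indices -/

/-- **Dictionary back to `Fin N`.**  On an all-Good `2D`-ball `x` is injective, so an abstract
development `Ψ` whose covered images are charted sites and whose bond relation is the bond
relation of the nine-deep sites is read as a map `Φ : ℝ³ → Fin N` with the STAR and LINK
clauses in the crux's language. [folklore] -/
theorem develop_translate {N : ℕ} (x : Fin N → EuclideanSpace ℝ (Fin 3)) (i : Fin N) (D : ℝ)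
    (hGood : ∀ j : Fin N, dist (x i) (x j) ≤ 2 * D → ((∀ j' : Fin N, dist (x j) (x j') ≤ 11 / 10 →
      ∀ k : Fin N, k ≠ j' → (55 : ℝ) / 57 ≤ dist (x j') (x k)) ∧ (Finset.univ.filter fun j' : Fin N
      => j' ≠ j ∧ dist (x j) (x j') ≤ 1).card = 12 ∧ (Finset.univ.filter fun j' : Fin N => j' ≠ j
      ∧ dist (x j) (x j') ≤ 11 / 10).card ≤ 12))
    {S : ℕ → Set (EuclideanSpace ℝ (Fin 3))}
    {B : EuclideanSpace ℝ (Fin 3) → EuclideanSpace ℝ (Fin 3) → Prop}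
    (hSx : ∀ (m : ℕ) (p : EuclideanSpace ℝ (Fin 3)), p ∈ S m →
      ∃ j : Fin N, p = x j ∧ dist (x i) (x j) + 10 + m ≤ 2 * D)
    (hB : ∀ p q : EuclideanSpace ℝ (Fin 3), B p q ↔ ∃ j k : Fin N, p = x j ∧ q = x k ∧ j ≠ k ∧
      dist (x j) (x k) ≤ 1 ∧ dist (x i) (x j) + 9 ≤ 2 * D ∧ dist (x i) (x k) + 9 ≤ 2 * D)
    {s : ℤ → ℤ} {Ψ : EuclideanSpace ℝ (Fin 3) → EuclideanSpace ℝ (Fin 3)} (b : Fin N)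
    (hΨ0 : Ψ (barlowPos 1 (Real.sqrt (2 / 3)) s 0 0 0) = x b) (hb : dist (x i) (x b) ≤ 2 * D)
    {n K R : ℕ}
    (hcov : ∀ k i' j' : ℤ, k.natAbs + 1 ≤ K → j'.natAbs + i'.natAbs + 3 * (k.natAbs + 1) + 4 ≤ R →
        Ψ (barlowPos 1 (Real.sqrt (2 / 3)) s k i' j') ∈ S n ∧
        Set.BijOn Ψ (contacts s (barlowPos 1 (Real.sqrt (2 / 3)) s k i' j'))
          {z | B (Ψ (barlowPos 1 (Real.sqrt (2 / 3)) s k i' j')) z} ∧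
        ∀ q ∈ contacts s (barlowPos 1 (Real.sqrt (2 / 3)) s k i' j'),
          ∀ q' ∈ contacts s (barlowPos 1 (Real.sqrt (2 / 3)) s k i' j'),
            (B (Ψ q) (Ψ q') ↔ dist q q' = 1)) :
    ∃ Φ : EuclideanSpace ℝ (Fin 3) → Fin N, Φ (barlowPos 1 (Real.sqrt (2 / 3)) s 0 0 0) = b ∧
      ∀ k i' j' : ℤ, k.natAbs + 1 ≤ K → j'.natAbs + i'.natAbs + 3 * (k.natAbs + 1) + 4 ≤ R →
        dist (x i) (x (Φ (barlowPos 1 (Real.sqrt (2 / 3)) s k i' j'))) + 10 + n ≤ 2 * D ∧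
        (∀ q ∈ barlowStacking 1 (Real.sqrt (2 / 3)) s,
          dist (barlowPos 1 (Real.sqrt (2 / 3)) s k i' j') q = 1 →
            Φ q ≠ Φ (barlowPos 1 (Real.sqrt (2 / 3)) s k i' j') ∧
            dist (x (Φ (barlowPos 1 (Real.sqrt (2 / 3)) s k i' j'))) (x (Φ q)) ≤ 1) ∧
        (∀ q ∈ barlowStacking 1 (Real.sqrt (2 / 3)) s, ∀ q' ∈ barlowStacking 1 (Real.sqrt (2 / 3)) s,
          dist (barlowPos 1 (Real.sqrt (2 / 3)) s k i' j') q = 1 →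
          dist (barlowPos 1 (Real.sqrt (2 / 3)) s k i' j') q' = 1 → Φ q = Φ q' → q = q') ∧
        (∀ l : Fin N, l ≠ Φ (barlowPos 1 (Real.sqrt (2 / 3)) s k i' j') →
          dist (x (Φ (barlowPos 1 (Real.sqrt (2 / 3)) s k i' j'))) (x l) ≤ 1 →
            ∃ q ∈ barlowStacking 1 (Real.sqrt (2 / 3)) s,
              dist (barlowPos 1 (Real.sqrt (2 / 3)) s k i' j') q = 1 ∧ Φ q = l) ∧
        (∀ q ∈ barlowStacking 1 (Real.sqrt (2 / 3)) s, ∀ q' ∈ barlowStacking 1 (Real.sqrt (2 / 3)) s,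
          dist (barlowPos 1 (Real.sqrt (2 / 3)) s k i' j') q = 1 →
          dist (barlowPos 1 (Real.sqrt (2 / 3)) s k i' j') q' = 1 → q ≠ q' →
            (dist (x (Φ q)) (x (Φ q')) ≤ 1 ↔ dist q q' = 1)) := by
  classical
  have hinjx : ∀ {j k : Fin N}, dist (x i) (x j) ≤ 2 * D → x j = x k → j = k :=
    fun hj h => window_injective x i D hGood hj h
  -- the index map
  set Φ : EuclideanSpace ℝ (Fin 3) → Fin N := fun p =>
    if h : ∃ j : Fin N, x j = Ψ p ∧ dist (x i) (x j) ≤ 2 * D then Classical.choose h else b with hΦ_def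
  have hΦ : ∀ (p : EuclideanSpace ℝ (Fin 3)) (j : Fin N), x j = Ψ p → dist (x i) (x j) ≤ 2 * D →
      Φ p = j := by
    intro p j hj hjD
    have h : ∃ j : Fin N, x j = Ψ p ∧ dist (x i) (x j) ≤ 2 * D := ⟨j, hj, hjD⟩
    have e : Φ p = Classical.choose h := by simp only [hΦ_def, dif_pos h]
    rw [e]
    exact hinjx (Classical.choose_spec h).2 ((Classical.choose_spec h).1.trans hj.symm)
  refine ⟨Φ, hΦ _ b hΨ0.symm hb, fun k i' j' hk hij => ?_⟩
  obtain ⟨hSn, hbij, hlink⟩ := hcov k i' j' hk hij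
  set p := barlowPos 1 (Real.sqrt (2 / 3)) s k i' j' with hp
  obtain ⟨j₀, hj₀, hj₀D⟩ := hSx n _ hSn
  have hΦp : Φ p = j₀ := hΦ p j₀ hj₀.symm (by linarith [dist_nonneg (x := x i) (y := x j₀)])
  -- images of contacts
  have hq : ∀ q ∈ contacts s p, ∃ l : Fin N, x l = Ψ q ∧ l ≠ j₀ ∧ dist (x j₀) (x l) ≤ 1 ∧
      dist (x i) (x l) + 9 ≤ 2 * D ∧ Φ q = l := by
    intro q hq
    have h1 : B (Ψ p) (Ψ q) := hbij.1 hq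
    rw [hB] at h1
    obtain ⟨j, l, hj, hl, hjl, hd, hjD, hlD⟩ := h1
    have hjj : j = j₀ := hinjx (by linarith) (hj.symm.trans hj₀)
    subst hjj
    exact ⟨l, hl.symm, hjl.symm, hd, hlD, hΦ q l hl.symm (by linarith [dist_nonneg (x := x i) (y := x l)])⟩
  have hcont : ∀ q, q ∈ barlowStacking 1 (Real.sqrt (2 / 3)) s → dist p q = 1 → q ∈ contacts s p :=
    fun q hq hd => ⟨hq, hd⟩
  refine ⟨by rw [hΦp]; exact hj₀D, ?_, ?_, ?_, ?_⟩
  · intro q hqS hqd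
    obtain ⟨l, -, hlj, hdl, -, hΦq⟩ := hq q (hcont q hqS hqd)
    rw [hΦq, hΦp]
    exact ⟨hlj, hdl⟩
  · intro q hqS q' hq'S hqd hq'd heq
    obtain ⟨l, hl, -, -, -, hΦq⟩ := hq q (hcont q hqS hqd)
    obtain ⟨l', hl', -, -, -, hΦq'⟩ := hq q' (hcont q' hq'S hq'd)
    have hll : l = l' := by rw [← hΦq, ← hΦq', heq]
    subst hll
    exact hbij.2.1 (hcont q hqS hqd) (hcont q' hq'S hq'd) (hl.symm.trans hl')
  · intro l hl hdl
    rw [hΦp] at hl hdl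
    have hBl : B (Ψ p) (x l) := by
      rw [hB]
      exact ⟨j₀, l, hj₀, rfl, hl.symm, hdl, by linarith, by
        linarith [dist_triangle (x i) (x j₀) (x l)]⟩
    obtain ⟨q, hqc, hqx⟩ := hbij.2.2 hBl
    exact ⟨q, hqc.1, hqc.2, hΦ q l hqx.symm (by linarith [dist_triangle (x i) (x j₀) (x l)])⟩
  · intro q hqS q' hq'S hqd hq'd hne
    obtain ⟨l, hl, -, -, hlD, hΦq⟩ := hq q (hcont q hqS hqd)
    obtain ⟨l', hl', -, -, hl'D, hΦq'⟩ := hq q' (hcont q' hq'S hq'd)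
    rw [hΦq, hΦq', ← hlink q (hcont q hqS hqd) q' (hcont q' hq'S hq'd), hB]
    constructor
    · intro hd
      refine ⟨l, l', hl.symm, hl'.symm, ?_, hd, hlD, hl'D⟩
      intro hll
      apply hne
      subst hll
      exact hbij.2.1 (hcont q hqS hqd) (hcont q' hq'S hq'd) (hl.symm.trans hl')
    · rintro ⟨j, j', hj, hj', -, hd, hjD, hjD'⟩
      have e1 : j = l := hinjx (by linarith) (hj.symm.trans hl.symm)
      have e2 : j' = l' := hinjx (by linarith) (hj'.symm.trans hl'.symm)
      subst e1 e2
      exact hd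


/-! ## The development from a deep base, in the crux's finite language -/

/-- **Finite development from a deep base site** (anchor of this file).  In an all-Good `2D`-ball
about `x i` with integer charts at the ten-deep sites and chart transfer along bonds, let `b` be a
site with `dist (x i) (x b) + 10 + (n + K + 4 + R) ≤ 2D` (`3K ≤ R`) which is hcp-like (some chart
at `b` is hcp-type), or all of whose charted companions within distance `n + K + 4 + R` are
fcc-like.  Then there are a Hägg word `s` and `Φ : ℝ³ → Fin N` with `Φ (barlowPos 1 √(2/3) s 0 0 0)
= b` such that for every covered model point `p = barlowPos 1 √(2/3) s k i' j'`
(`|k| + 1 ≤ K`, `|j'| + |i'| + 3(|k| + 1) + 4 ≤ R`): `Φ p` is `(10 + n)`-deep, the twelve model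
contacts of `p` are mapped injectively onto the bonded neighbours of `Φ p` (STAR), and two distinct
contacts are bonded iff they touch in the model (LINK). [folklore] -/
theorem develop_of_base :
    ∀ (N : ℕ) (x : Fin N → EuclideanSpace ℝ (Fin 3)) (i : Fin N) (D : ℝ), (∀ j : Fin N, dist (x
    i) (x j) ≤ 2 * D → ((∀ j' : Fin N, dist (x j) (x j') ≤ 11 / 10 → ∀ k : Fin N, k ≠ j' → (55 :
    ℝ) / 57 ≤ dist (x j') (x k)) ∧ (Finset.univ.filter fun j' : Fin N => j' ≠ j ∧ dist (x j) (x
    j') ≤ 1).card = 12 ∧ (Finset.univ.filter fun j' : Fin N => j' ≠ j ∧ dist (x j) (x j') ≤ 11 /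
    10).card ≤ 12)) → (∀ j : Fin N, dist (x i) (x j) + 10 ≤ 2 * D → ∃ (T : Fin 12 → Fin 3 → ℤ)
    (e : Fin 12 → Fin N), (((T = fun a : Fin 12 => 3 • fccTab a) ∨ T = hcpTab) ∧
    Function.Injective e ∧ (∀ a : Fin 12, e a ≠ j ∧ dist (x j) (x (e a)) ≤ 1) ∧ (∀ k : Fin N, k
    ≠ j → dist (x j) (x k) ≤ 1 → ∃ a : Fin 12, e a = k) ∧ (∀ a b : Fin 12, a ≠ b → (dist (x (e
    a)) (x (e b)) ≤ 1 ↔ sqNormInt (T a - T b) = 18)))) → (∀ (j j' : Fin N) (T T' : Fin 12 → Fin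
    3 → ℤ) (e e' : Fin 12 → Fin N), dist (x i) (x j) + 10 ≤ 2 * D → dist (x i) (x j') + 10 ≤ 2 *
    D → j ≠ j' → dist (x j) (x j') ≤ 1 → (((T = fun a : Fin 12 => 3 • fccTab a) ∨ T = hcpTab) ∧
    Function.Injective e ∧ (∀ a : Fin 12, e a ≠ j ∧ dist (x j) (x (e a)) ≤ 1) ∧ (∀ k : Fin N, k
    ≠ j → dist (x j) (x k) ≤ 1 → ∃ a : Fin 12, e a = k) ∧ (∀ a b : Fin 12, a ≠ b → (dist (x (e
    a)) (x (e b)) ≤ 1 ↔ sqNormInt (T a - T b) = 18))) → (((T' = fun a : Fin 12 => 3 • fccTab a)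
    ∨ T' = hcpTab) ∧ Function.Injective e' ∧ (∀ a : Fin 12, e' a ≠ j' ∧ dist (x j') (x (e' a)) ≤
    1) ∧ (∀ k : Fin N, k ≠ j' → dist (x j') (x k) ≤ 1 → ∃ a : Fin 12, e' a = k) ∧ (∀ a b : Fin
    12, a ≠ b → (dist (x (e' a)) (x (e' b)) ≤ 1 ↔ sqNormInt (T' a - T' b) = 18))) → ∀ a a' b b'
    : Fin 12, e a = e' b → e a' = e' b' → sqNormInt (T a - T a') = sqNormInt (T' b - T' b')) → ∀
    (b : Fin N) (n K R : ℕ), 3 * K ≤ R → dist (x i) (x b) + 10 + ((n + K + 4 + R : ℕ) : ℝ) ≤ 2 *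
    D → ((∃ (T : Fin 12 → Fin 3 → ℤ) (e : Fin 12 → Fin N), (((T = fun a : Fin 12 => 3 • fccTab
    a) ∨ T = hcpTab) ∧ Function.Injective e ∧ (∀ a : Fin 12, e a ≠ b ∧ dist (x b) (x (e a)) ≤ 1)
    ∧ (∀ k : Fin N, k ≠ b → dist (x b) (x k) ≤ 1 → ∃ a : Fin 12, e a = k) ∧ (∀ a b : Fin 12, a ≠
    b → (dist (x (e a)) (x (e b)) ≤ 1 ↔ sqNormInt (T a - T b) = 18))) ∧ T = hcpTab) ∨ (∀ j : Fin
    N, dist (x b) (x j) ≤ ((n + K + 4 + R : ℕ) : ℝ) → dist (x i) (x j) + 10 ≤ 2 * D → ∀ (T : Fin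
    12 → Fin 3 → ℤ) (e : Fin 12 → Fin N), (((T = fun a : Fin 12 => 3 • fccTab a) ∨ T = hcpTab) ∧
    Function.Injective e ∧ (∀ a : Fin 12, e a ≠ j ∧ dist (x j) (x (e a)) ≤ 1) ∧ (∀ k : Fin N, k
    ≠ j → dist (x j) (x k) ≤ 1 → ∃ a : Fin 12, e a = k) ∧ (∀ a b : Fin 12, a ≠ b → (dist (x (e
    a)) (x (e b)) ≤ 1 ↔ sqNormInt (T a - T b) = 18))) → T = fun a : Fin 12 => 3 • fccTab a)) → ∃
    s : ℤ → ℤ, IsHaggSeq s ∧ ∃ Φ : EuclideanSpace ℝ (Fin 3) → Fin N, Φ (barlowPos 1 (Real.sqrt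
    (2 / 3)) s 0 0 0) = b ∧ ∀ k i' j' : ℤ, k.natAbs + 1 ≤ K → j'.natAbs + i'.natAbs + 3 *
    (k.natAbs + 1) + 4 ≤ R → dist (x i) (x (Φ (barlowPos 1 (Real.sqrt (2 / 3)) s k i' j'))) + 10
    + n ≤ 2 * D ∧ (∀ q ∈ barlowStacking 1 (Real.sqrt (2 / 3)) s, dist (barlowPos 1 (Real.sqrt (2
    / 3)) s k i' j') q = 1 → Φ q ≠ Φ (barlowPos 1 (Real.sqrt (2 / 3)) s k i' j') ∧ dist (x (Φ
    (barlowPos 1 (Real.sqrt (2 / 3)) s k i' j'))) (x (Φ q)) ≤ 1) ∧ (∀ q ∈ barlowStacking 1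
    (Real.sqrt (2 / 3)) s, ∀ q' ∈ barlowStacking 1 (Real.sqrt (2 / 3)) s, dist (barlowPos 1
    (Real.sqrt (2 / 3)) s k i' j') q = 1 → dist (barlowPos 1 (Real.sqrt (2 / 3)) s k i' j') q' =
    1 → Φ q = Φ q' → q = q') ∧ (∀ l : Fin N, l ≠ Φ (barlowPos 1 (Real.sqrt (2 / 3)) s k i' j') →
    dist (x (Φ (barlowPos 1 (Real.sqrt (2 / 3)) s k i' j'))) (x l) ≤ 1 → ∃ q ∈ barlowStacking 1
    (Real.sqrt (2 / 3)) s, dist (barlowPos 1 (Real.sqrt (2 / 3)) s k i' j') q = 1 ∧ Φ q = l) ∧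
    (∀ q ∈ barlowStacking 1 (Real.sqrt (2 / 3)) s, ∀ q' ∈ barlowStacking 1 (Real.sqrt (2 / 3))
    s, dist (barlowPos 1 (Real.sqrt (2 / 3)) s k i' j') q = 1 → dist (barlowPos 1 (Real.sqrt (2
    / 3)) s k i' j') q' = 1 → q ≠ q' → (dist (x (Φ q)) (x (Φ q')) ≤ 1 ↔ dist q q' = 1)) :=
  by
  intro N x i D hGood hCharts hTransfer b n K R hKR hb hreg
  classical
  -- the graded chart data of the window
  set S : ℕ → Set (EuclideanSpace ℝ (Fin 3)) := fun m =>
    {p | ∃ j : Fin N, p = x j ∧ dist (x i) (x j) + 10 + m ≤ 2 * D} with hS_def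
  set B : EuclideanSpace ℝ (Fin 3) → EuclideanSpace ℝ (Fin 3) → Prop := fun p q =>
    ∃ j k : Fin N, p = x j ∧ q = x k ∧ j ≠ k ∧ dist (x j) (x k) ≤ 1 ∧
      dist (x i) (x j) + 9 ≤ 2 * D ∧ dist (x i) (x k) + 9 ≤ 2 * D with hB_def
  have hS : ∀ (m : ℕ) (p : EuclideanSpace ℝ (Fin 3)),
      p ∈ S m ↔ ∃ j : Fin N, p = x j ∧ dist (x i) (x j) + 10 + m ≤ 2 * D := fun _ _ => Iff.rfl
  have hB : ∀ p q : EuclideanSpace ℝ (Fin 3), B p q ↔ ∃ j k : Fin N, p = x j ∧ q = x k ∧ j ≠ k ∧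
      dist (x j) (x k) ≤ 1 ∧ dist (x i) (x j) + 9 ≤ 2 * D ∧ dist (x i) (x k) + 9 ≤ 2 * D :=
    fun _ _ => Iff.rfl
  obtain ⟨Pc, nb, hch, hdict⟩ := gradedData_of_charts x i D hGood hCharts hTransfer S hS B hB
  have hmono : ∀ m a : ℕ, S (m + a) ⊆ S m := by
    rintro m a p ⟨j, rfl, hj⟩
    exact ⟨j, rfl, window_levels_antitone N x i D m a j hj⟩
  have hSx : ∀ (m : ℕ) (p : EuclideanSpace ℝ (Fin 3)), p ∈ S m →
      ∃ j : Fin N, p = x j ∧ dist (x i) (x j) + 10 + m ≤ 2 * D := fun m p hp => hp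
  have hBd : ∀ p q, B p q → dist p q ≤ 1 := by
    rintro p q ⟨j, k, rfl, rfl, -, hd, -⟩; exact hd
  have hcast : ((n + K + 4 + R : ℕ) : ℝ) = (n : ℝ) + K + 4 + R := by push_cast; ring
  have hbS : x b ∈ S (n + K + 4 + R) := ⟨b, rfl, hb⟩
  have hb10 : dist (x i) (x b) + 10 ≤ 2 * D := by
    rw [hcast] at hb
    linarith [(Nat.cast_nonneg n : (0 : ℝ) ≤ n), (Nat.cast_nonneg K : (0 : ℝ) ≤ K),
      (Nat.cast_nonneg R : (0 : ℝ) ≤ R)]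
  have hbD : dist (x i) (x b) ≤ 2 * D := by linarith
  -- the pattern at a charted site from the type of any of its charts
  have hPc_of : ∀ j : Fin N, dist (x i) (x j) + 10 ≤ 2 * D →
      ∀ (T : Fin 12 → Fin 3 → ℤ) (e : Fin 12 → Fin N),
        (((T = fun a : Fin 12 => 3 • fccTab a) ∨ T = hcpTab) ∧ Function.Injective e ∧
          (∀ a : Fin 12, e a ≠ j ∧ dist (x j) (x (e a)) ≤ 1) ∧
          (∀ k : Fin N, k ≠ j → dist (x j) (x k) ≤ 1 → ∃ a : Fin 12, e a = k) ∧
          (∀ a b : Fin 12, a ≠ b → (dist (x (e a)) (x (e b)) ≤ 1 ↔ sqNormInt (T a - T b) = 18))) →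
        (T = hcpTab → Pc (x j) = hcpInt) ∧ ((T = fun a : Fin 12 => 3 • fccTab a) → Pc (x j) = fcc3Int) := by
    intro j hj T e hc
    obtain ⟨T₀, e₀, hc₀, hP, -⟩ := hdict j hj
    have hiff := zchart_hcp_iff x j hc hc₀
    constructor
    · intro h
      rw [hP, hiff.1 h]
      exact image_tables.2
    · intro h
      rcases hc₀.1 with h₀ | h₀
      · rw [hP, h₀]; exact image_tables.1
      · exfalso
        have := hiff.2 h₀
        subst this
        have e18 : (fun a : Fin 12 => 3 • fccTab a) 0 = hcpTab 0 := by rw [h]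
        revert e18; decide
  rcases hreg with ⟨T, e, hc, hT⟩ | hfcc
  · -- hcp-like base
    have hPb : Pc (x b) = hcpInt := (hPc_of b hb10 T e hc).1 hT
    let g₀ : ZFrame := ⟨x b, ![-3, 3, 0], ![-3, 0, 3], {![0, 3, 3], ![3, 0, 3], ![3, 3, 0]}⟩
    have h₀ : IsFrame (Pc g₀.pt) g₀.t₁ g₀.t₂ g₀.U := by
      show IsFrame (Pc (x b)) ![-3, 3, 0] ![-3, 0, 3] {![0, 3, 3], ![3, 0, 3], ![3, 3, 0]}
      rw [hPb]; exact hcpBaseFrame.1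
    obtain ⟨s, hs, Ψ, hΨ0, hcov⟩ := develop_abstract hch hmono h₀ hbS hcpBaseFrame.2 (Or.inr hPb) hKR
    obtain ⟨Φ, hΦ⟩ := develop_translate x i D hGood hSx hB b hΨ0 hbD hcov
    exact ⟨s, hs, Φ, hΦ⟩
  · -- all-fcc regime about `b`: restrict the graded data
    set S' : ℕ → Set (EuclideanSpace ℝ (Fin 3)) := fun m =>
      {z | z ∈ S m ∧ ∀ m' : ℕ, ∀ y ∈ S m', dist z y ≤ m → Pc y = fcc3Int} with hS'_def
    have hS' : ∀ (m : ℕ) (z : EuclideanSpace ℝ (Fin 3)), z ∈ S' m ↔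
        z ∈ S m ∧ ∀ m' : ℕ, ∀ y ∈ S m', dist z y ≤ m → Pc y = fcc3Int := fun _ _ => Iff.rfl
    obtain ⟨hch', hF⟩ := hch_restrict_fcc hch hBd S' hS'
    have hmono' : ∀ m a : ℕ, S' (m + a) ⊆ S' m := by
      rintro m a z ⟨hz, hfz⟩
      refine ⟨hmono m a hz, fun m' y hy hd => hfz m' y hy (hd.trans ?_)⟩
      push_cast
      linarith [(Nat.cast_nonneg a : (0 : ℝ) ≤ a)]
    have hSx' : ∀ (m : ℕ) (p : EuclideanSpace ℝ (Fin 3)), p ∈ S' m →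
        ∃ j : Fin N, p = x j ∧ dist (x i) (x j) + 10 + m ≤ 2 * D := fun m p hp => hp.1
    have hbS' : x b ∈ S' (n + K + 4 + R) := by
      refine ⟨hbS, ?_⟩
      rintro m' _ ⟨j, rfl, hj⟩ hd
      have hj10 : dist (x i) (x j) + 10 ≤ 2 * D := by
        linarith [(Nat.cast_nonneg m' : (0 : ℝ) ≤ m')]
      obtain ⟨T₀, e₀, hc₀, -, -⟩ := hdict j hj10
      exact (hPc_of j hj10 T₀ e₀ hc₀).2 (hfcc j hd hj10 T₀ e₀ hc₀)
    have hPb : Pc (x b) = fcc3Int := hF _ _ hbS'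
    let g₀ : ZFrame := ⟨x b, ![3, 3, 0], ![3, 0, 3], {![0, 3, 3], ![-3, 0, 3], ![-3, 3, 0]}⟩
    have h₀ : IsFrame (Pc g₀.pt) g₀.t₁ g₀.t₂ g₀.U := by
      show IsFrame (Pc (x b)) ![3, 3, 0] ![3, 0, 3] {![0, 3, 3], ![-3, 0, 3], ![-3, 3, 0]}
      rw [hPb]; exact fccBaseFrame.1
    obtain ⟨s, hs, Ψ, hΨ0, hcov⟩ := develop_abstract hch' hmono' h₀ hbS' fccBaseFrame.2 (Or.inl hF) hKR
    obtain ⟨Φ, hΦ⟩ := develop_translate x i D hGood hSx' hB b hΨ0 hbD hcov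
    exact ⟨s, hs, Φ, hΦ⟩

end Summit.AtomisticToContinuum.Crystallization.Theorems.SquareWellLayerCakeGapTwelveToBarlow
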